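import Summits.BirchSwinnertonDyer.BirchSwinnertonDyer.Theorems.QuadraticBranchSignedControlPlusEtaNonsurjConjADoorHeckeUpperAuto
import Summits.BirchSwinnertonDyer.BirchSwinnertonDyer.Theorems.SignedLowerHalvesSprungLowerDivisibilityAtThreeControlAtT
import Summits.BirchSwinnertonDyer.Rank1Residual.X11b.ChaPairsMinimality
import HarnessLib

/-!
# Route `QuadraticBranchSignedControl` (rung K8, cell `bsd-potss`), residual crux `PlusEtaMainConjectureNonsurj`
# (stmt-BirchSwinnertonDyer-19606): RECORDS THROUGH THE HECKE DOOR — (C1⁺_η) at `p = 5` on the six prime-`L` rank-one rows of the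
# k8eta-c2 g21 census whose ONLY class-group door is the Hecke-refined eigen-test (seat `bsd-potss-k8eta-c2` g21; kit j326603 / j326822, GRH)

WHAT. p706394 (`EtaConjADoorHecke.conjA_partner_of_heckeEigenHom_auto`: the fact-free Hecke door with `hVH` discharged) and its fine-road
composition `quadraticBranchPlusEtaMainConjectureAt_of_heckeEigenHom_of_span_eq_span_X_auto` (`…ConjADoorHeckeUpperAuto`) give (C1⁺_η) on the
prime-`L` rank-`1` shape from the ROW ALONE: named facts `h22 h41 h6273` (Kobayashi 2003) + `hGZK` (`Sel_{5^∞}(W/ℚ)` infinite from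
`r_an(W) = 1`); displayed per row: `r_an(W) = 1`, the tower clause, the shape `(L_5⁺(V,η,X)) = (X)` (PARI `λ⁺ = 1, μ⁺ = 0`) and the
HECKE-REFINED tautological eigen datum on `Cl(ℚ(P)) ⊗ 𝔽₅` for one `P ∈ W[5] ∖ 0` (every additive `μ : Cl(𝓞_{ℚ(P)}) → ℤ/5` satisfying the
tautological relations AND the Hecke relations vanishes). §1 the row-generic form `etaMC_r1_of_heckeEigenHom`; §2 three of the six in-table rows (the other three in `…ConjADoorHeckeRecordsB`) of the
k8eta-c2 g21 classification (`E5-CLASSIFICATION-k8eta-c2-g21.tsv`, door `PASS:L4 Hecke`, prime-`L` rank-one shape) — ALL CM, all with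
`5 ∣ h(ℚ(P))`, `5 ∤ h(ℚ(x(P)))` or `v₅ h > v₅ hₓ` (the plain class-number door AND door L6⁻ are void) and a tautological `σ₂ = 2` eigenclass of
dimension `d₂ = 1 = s_W + s_V` with `s_W = 0`, `s_V = 1` coming from the Mordell–Weil `Sel₀(ℚ, V[5])` of the ROW curve `V = W^{(5)}`; kit
j326822 (hecke13): verdict TWIST (`c ≠ Tr`) on five rows, `T = 0` on 378225bg1 (`j = 0`, cubic-twist companion):
`44100j1 = [0,0,0,0,−3500]` (`h/hₓ = 60/3`, `c = 1`, `Tr = 4`), `243675bl1 = [0,0,1,0,11281]` (`15/3`, `c = 1`, `Tr = 4`),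
`324900en1 = [0,0,0,0,−857375]` (`20/1`, `c = 1`, `Tr = 4`), `148225cc1 = [1,−1,0,−6617,256416]` (`40/1`, `c = 2`, `Tr = 3`),
`378225bg1 = [0,0,1,0,1281]` (`1200/30`, `T = 0`, `Tr = 2`), `326700ga1 = [0,0,0,0,−1375]` (`360/18`, `c = 3`, `Tr = 2`); Cremona `r_an(W) = 1`,
PARI plus-`η` `(λ, μ) = (1, 0)` on each (g20 QP5-ROADS / g21 E5-CLASSIFICATION).

HONEST FRAMING (cell `bsd-potss`; FULL-BSD rank ≤ 1 programme, HUMAN RULING D-0036/D-0074): per-row RECORDS, CONDITIONAL on the displayed named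
facts and per-row inputs; the class-group / Hecke data are GRH numerics (evidence, not facts); no stub of 19606 is proved by name; the crux stays
OPEN; nothing is booked; `BSD(W,5)` is claimed for no pair. `--supports stmt-BirchSwinnertonDyer-19606`.

References: [Kobayashi2003] §4 (p. 8), Thm. 4.1, Thm. 2.2, Thm. 7.3 i); [CoatesSujatha2005] §3 (A); [DeoRaySujatha2023] Thm. 3.8; [GrossZagier1986] Thm. (7.3);
[Kolyvagin1990] Thm. A; [Cremona1997] Table 1 (labels as listed).
-/

set_option autoImplicit false
set_option linter.dupNamespace false
noncomputable section

open scoped Classical nonZeroDivisors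

open CongruenceSubgroup NumberField Field WeierstrassCurve
open Literature.NumberTheory.EllipticCurves Literature.NumberTheory.EllipticCurves.ModularForms
  Literature.NumberTheory.EllipticCurves.Rank1Residual Literature.NumberTheory.EllipticCurves.Rank1Residual.Typed
  Literature.NumberTheory.GaloisRepresentations Literature.NumberTheory.GaloisCohomology Literature.NumberTheory.NumberFields
  Literature.NumberTheory.EllipticCurves.GreenbergVatsal2000 ZpExtension
open Summit.BirchSwinnertonDyer.Rank1Residual Summit.BirchSwinnertonDyer.Rank1Residual.Additive
open Summit.BirchSwinnertonDyer.Rank1Residual.X11b (isElliptic_of_discOf_ne_zero)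
open Summit.BirchSwinnertonDyer.BirchSwinnertonDyer.Theorems

namespace Summit.BirchSwinnertonDyer.BirchSwinnertonDyer.Theorems.EtaConjADoorHeckeRecords

/-! ## §1 Row-generic form -/

/-- **(C1⁺_η) on a prime-`L` rank-one row from the HECKE-REFINED eigen datum** (row-generic record shape): `W/ℚ` elliptic with `r_an(W) = 1`,
`p ≥ 5`, `V` a globally minimal good `a_p = 0` model of `W^{(p*)}` whose `p`-adic tower is not onto, `(L_p⁺(V,η,X)) = (X)`, and one
`P ∈ W[p] ∖ 0` on whose stabiliser field `K = ℚ(P)` every additive `μ : Cl(𝓞_K) → ℤ/p` with the tautological AND the Hecke relations vanishes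
⟹ `QuadraticBranchPlusEtaMainConjectureAt V p`. Named facts `h22 h41 h6273 hGZK`; `…UpperAuto`'s
`quadraticBranchPlusEtaMainConjectureAt_of_heckeEigenHom_of_span_eq_span_X_auto` with `Sel_{p^∞}(W/ℚ)` infinite from `r_an = 1`
(`ChromaticCommonZerosControlAtT.not_finite_selmerGroupPInfty_of_analyticRank_eq_one`). CONDITIONAL; nothing booked.
[cite: Kobayashi2003, §4 Even main conjecture (p. 8)] [cite: DeoRaySujatha2023, §3 Thm. 3.8 (arXiv:2202.09937 p. 9)] [cite: GrossZagier1986, Thm. (7.3)]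
[cite: Kolyvagin1990, Thm. A] -/
theorem etaMC_r1_of_heckeEigenHom
    (h22 : Kobayashi2003.thm22_etaSignedSelmerDual_finite_torsion)
    (h41 : Kobayashi2003.thm41_plusEtaCharIdeal_dvd)
    (h6273 : Kobayashi2003.thm62_63_73_etaColemanPoitouTate)
    (hGZK : rank_eq_analyticRank_of_analyticRank_le_one)
    (p : ℕ) [Fact p.Prime] [NeZero p] (hp5 : 5 ≤ p)
    (W : WeierstrassCurve ℚ) [W.IsElliptic] (hr : W.analyticRank = 1)
    (V : WeierstrassCurve ℚ) [V.IsElliptic] [V.IsGloballyMinimal] (C : VariableChange ℚ)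
    (hC : C • W.quadraticTwist ((-1) ^ (p / 2) * p) = V)
    (hgood : V.HasGoodReductionAtPrime p) (hap : V.frobeniusTrace p = 0)
    (hns : ¬ ∀ m : ℕ, V.HasSurjectiveModNGaloisRep (p ^ m : ℕ))
    (hX : ∀ {N : ℕ} [NeZero N] {f : CuspForm (Gamma0 N) 2}, IsNewformOf V f →
      ∀ (ϖ : ℚ), (if Even (p / 2) then (ϖ : ℝ) * V.realPeriodRat = plusPeriod f
          else (ϖ : ℝ) * V.imaginaryPeriodRat = minusPeriod f) →
      ∀ (Lη : IwasawaAlgebra p), IsQuadraticBranchPlusLFunction f p ϖ Lη →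
        Ideal.span {Lη} = Ideal.span {(PowerSeries.X : IwasawaAlgebra p)})
    (hP : haveI : NumberField (W.divisionField p) := NumberField.mk
      ∃ P : geomTorsion W (p : ℤ), P ≠ 0 ∧
        ∀ K : IntermediateField ℚ (W.divisionField p),
          K = IntermediateField.fixedField
            ((MulAction.stabilizer (absoluteGaloisGroup ℚ) P).map (absRestrictNormalHom (W.divisionField p))) →
        ∀ μ : Additive (ClassGroup (𝓞 K)) →+ ZMod p,
          (∀ (τ : absoluteGaloisGroup ℚ) (σ : K ≃ₐ[ℚ] K) (a : ℕ),
              (∀ x : K, absRestrictNormalHom (W.divisionField p) τ (x : W.divisionField p) =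
                ((σ x : K) : W.divisionField p)) → τ • P = a • P →
              ∀ (I J : (Ideal (𝓞 K))⁰),
                (J : Ideal (𝓞 K)) = (I : Ideal (𝓞 K)).map (AmbiguousClass.intAut σ : 𝓞 K →+* 𝓞 K) →
                μ (Additive.ofMul (ClassGroup.mk0 J)) = a • μ (Additive.ofMul (ClassGroup.mk0 I))) →
          (∀ (τ τ₁ : absoluteGaloisGroup ℚ) (a a₁ b : ℕ) (Q : geomTorsion W (p : ℤ)),
              τ • P = a • P + Q → τ₁ • P = a₁ • P → τ₁ • Q = b • Q → (a₁ : ZMod p) ≠ (b : ZMod p) →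
              ∀ I : (Ideal (𝓞 K))⁰,
                μ (Additive.ofMul (classGroupNorm K (W.divisionField p) (ClassGroup.mulEquiv
                  (AmbiguousClass.intAut (absRestrictNormalHom (W.divisionField p) τ))
                    (classGroupExtend K (W.divisionField p) (ClassGroup.mk0 I))))) =
                  (Nat.card ((W.divisionField p) ≃ₐ[K] (W.divisionField p)) * a) •
                    μ (Additive.ofMul (ClassGroup.mk0 I))) →
          μ = 0) :
    QuadraticBranchPlusEtaMainConjectureAt V p :=
  EtaConjADoorHecke.quadraticBranchPlusEtaMainConjectureAt_of_heckeEigenHom_of_span_eq_span_X_auto p V W C h22 h41 h6273 hp5 hC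
    hgood hap hns (ChromaticCommonZerosControlAtT.not_finite_selmerGroupPInfty_of_analyticRank_eq_one hGZK W p hr) hX hP

/-! ## §2 Rows 44100j1, 243675bl1, 324900en1 (the other three: `…ConjADoorHeckeRecordsB`) -/

/-- `44100j1` = `[0, 0, 0, 0, -3500]` (CM, `j = 0`, `N = 44100`): `Δ ≠ 0` (kernel). [cite: Cremona1997, Table 1 (label 44100j1)] -/
theorem isElliptic_44100j1 : (⟨0, 0, 0, 0, (-3500)⟩ : WeierstrassCurve ℚ).IsElliptic :=
  isElliptic_of_discOf_ne_zero 0 0 0 0 (-3500) (by decide +kernel)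

/-- **(C1⁺_η) at `p = 5` for every good `a_5 = 0` model `V` of the `5`-twist of `44100j1`** (`W = [0, 0, 0, 0, -3500]`, CM, `j = 0`, `N = 44100`;
Cremona `r_an(W) = 1`; PARI plus-`η` `(λ, μ) = (1, 0)`; census j326603 / j326929 / j326822 (GRH): `h(ℚ(P)) = 60`, `h(ℚ(x(P))) = 3`, `d₂ = 1 = s_W + s_V` with `s_W = 0`; hecke13 (j326822): TWIST, `c = 1 ≠ Tr ρ̄(τ) = 4` — the plain class-number door and
door L6⁻ are VOID, the Hecke door passes: the tautological class comes from the ROW curve `V = W^5`, not from `W`) from the ROW ALONE —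
named facts `h22 h41 h6273 hGZK`; displayed `r_an(W) = 1`, the tower clause, `(L_5⁺(V,η,X)) = (X)`, the Hecke-refined eigen datum. Instance of
`etaMC_r1_of_heckeEigenHom`. CONDITIONAL; nothing booked. [cite: Kobayashi2003, §4 (p. 8)] [cite: DeoRaySujatha2023, §3 Thm. 3.8]
[cite: Cremona1997, Table 1 (label 44100j1)] -/
theorem etaMC_r1_44100j1_5_of_heckeEigenHom
    (h22 : Kobayashi2003.thm22_etaSignedSelmerDual_finite_torsion)
    (h41 : Kobayashi2003.thm41_plusEtaCharIdeal_dvd)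
    (h6273 : Kobayashi2003.thm62_63_73_etaColemanPoitouTate)
    (hGZK : rank_eq_analyticRank_of_analyticRank_le_one) [Fact (5 : ℕ).Prime]
    (W : WeierstrassCurve ℚ) (hW : W = (⟨0, 0, 0, 0, (-3500)⟩ : WeierstrassCurve ℚ)) (hr : W.analyticRank = 1)
    (V : WeierstrassCurve ℚ) [V.IsElliptic] [V.IsGloballyMinimal] (C : VariableChange ℚ)
    (hC : C • W.quadraticTwist 5 = V)
    (hgood : V.HasGoodReductionAtPrime 5) (hap : V.frobeniusTrace 5 = 0)
    (hns : ¬ ∀ m : ℕ, V.HasSurjectiveModNGaloisRep (5 ^ m : ℕ))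
    (hX : ∀ {N : ℕ} [NeZero N] {f : CuspForm (Gamma0 N) 2}, IsNewformOf V f →
      ∀ (ϖ : ℚ), (if Even (5 / 2) then (ϖ : ℝ) * V.realPeriodRat = plusPeriod f
          else (ϖ : ℝ) * V.imaginaryPeriodRat = minusPeriod f) →
      ∀ (Lη : IwasawaAlgebra 5), IsQuadraticBranchPlusLFunction f 5 ϖ Lη →
        Ideal.span {Lη} = Ideal.span {(PowerSeries.X : IwasawaAlgebra 5)})
    (hP : haveI : W.IsElliptic := hW ▸ isElliptic_44100j1
      haveI : NeZero (5 : ℕ) := ⟨by norm_num⟩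
      haveI : NumberField (W.divisionField 5) := NumberField.mk
      ∃ P : geomTorsion W ((5 : ℕ) : ℤ), P ≠ 0 ∧
        ∀ K : IntermediateField ℚ (W.divisionField 5),
          K = IntermediateField.fixedField
            ((MulAction.stabilizer (absoluteGaloisGroup ℚ) P).map (absRestrictNormalHom (W.divisionField 5))) →
        ∀ μ : Additive (ClassGroup (𝓞 K)) →+ ZMod 5,
          (∀ (τ : absoluteGaloisGroup ℚ) (σ : K ≃ₐ[ℚ] K) (a : ℕ),
              (∀ x : K, absRestrictNormalHom (W.divisionField 5) τ (x : W.divisionField 5) =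
                ((σ x : K) : W.divisionField 5)) → τ • P = a • P →
              ∀ (I J : (Ideal (𝓞 K))⁰),
                (J : Ideal (𝓞 K)) = (I : Ideal (𝓞 K)).map (AmbiguousClass.intAut σ : 𝓞 K →+* 𝓞 K) →
                μ (Additive.ofMul (ClassGroup.mk0 J)) = a • μ (Additive.ofMul (ClassGroup.mk0 I))) →
          (∀ (τ τ₁ : absoluteGaloisGroup ℚ) (a a₁ b : ℕ) (Q : geomTorsion W ((5 : ℕ) : ℤ)),
              τ • P = a • P + Q → τ₁ • P = a₁ • P → τ₁ • Q = b • Q → (a₁ : ZMod 5) ≠ (b : ZMod 5) →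
              ∀ I : (Ideal (𝓞 K))⁰,
                μ (Additive.ofMul (classGroupNorm K (W.divisionField 5) (ClassGroup.mulEquiv
                  (AmbiguousClass.intAut (absRestrictNormalHom (W.divisionField 5) τ))
                    (classGroupExtend K (W.divisionField 5) (ClassGroup.mk0 I))))) =
                  (Nat.card ((W.divisionField 5) ≃ₐ[K] (W.divisionField 5)) * a) •
                    μ (Additive.ofMul (ClassGroup.mk0 I))) →
          μ = 0) :
    QuadraticBranchPlusEtaMainConjectureAt V 5 := by
  subst hW
  haveI : (⟨0, 0, 0, 0, (-3500)⟩ : WeierstrassCurve ℚ).IsElliptic := isElliptic_44100j1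
  haveI : NeZero (5 : ℕ) := ⟨by norm_num⟩
  exact etaMC_r1_of_heckeEigenHom h22 h41 h6273 hGZK 5 (le_refl 5) _ hr V C
    (by rw [show ((-1 : ℚ) ^ ((5 : ℕ) / 2) * ((5 : ℕ) : ℚ)) = 5 by norm_num]; exact hC) hgood hap hns hX hP

/-- `243675bl1` = `[0, 0, 1, 0, 11281]` (CM, `j = 0`, `N = 243675`): `Δ ≠ 0` (kernel). [cite: Cremona1997, Table 1 (label 243675bl1)] -/
theorem isElliptic_243675bl1 : (⟨0, 0, 1, 0, 11281⟩ : WeierstrassCurve ℚ).IsElliptic :=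
  isElliptic_of_discOf_ne_zero 0 0 1 0 11281 (by decide +kernel)

/-- **(C1⁺_η) at `p = 5` for every good `a_5 = 0` model `V` of the `5`-twist of `243675bl1`** (`W = [0, 0, 1, 0, 11281]`, CM, `j = 0`, `N = 243675`;
Cremona `r_an(W) = 1`; PARI plus-`η` `(λ, μ) = (1, 0)`; census j326603 / j326929 / j326822 (GRH): `h(ℚ(P)) = 15`, `h(ℚ(x(P))) = 3`, `d₂ = 1`, `s_W = 0`; hecke13: TWIST, `c = 1 ≠ Tr = 4` — the plain class-number door and
door L6⁻ are VOID, the Hecke door passes: the tautological class comes from the ROW curve `V = W^5`, not from `W`) from the ROW ALONE —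
named facts `h22 h41 h6273 hGZK`; displayed `r_an(W) = 1`, the tower clause, `(L_5⁺(V,η,X)) = (X)`, the Hecke-refined eigen datum. Instance of
`etaMC_r1_of_heckeEigenHom`. CONDITIONAL; nothing booked. [cite: Kobayashi2003, §4 (p. 8)] [cite: DeoRaySujatha2023, §3 Thm. 3.8]
[cite: Cremona1997, Table 1 (label 243675bl1)] -/
theorem etaMC_r1_243675bl1_5_of_heckeEigenHom
    (h22 : Kobayashi2003.thm22_etaSignedSelmerDual_finite_torsion)
    (h41 : Kobayashi2003.thm41_plusEtaCharIdeal_dvd)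
    (h6273 : Kobayashi2003.thm62_63_73_etaColemanPoitouTate)
    (hGZK : rank_eq_analyticRank_of_analyticRank_le_one) [Fact (5 : ℕ).Prime]
    (W : WeierstrassCurve ℚ) (hW : W = (⟨0, 0, 1, 0, 11281⟩ : WeierstrassCurve ℚ)) (hr : W.analyticRank = 1)
    (V : WeierstrassCurve ℚ) [V.IsElliptic] [V.IsGloballyMinimal] (C : VariableChange ℚ)
    (hC : C • W.quadraticTwist 5 = V)
    (hgood : V.HasGoodReductionAtPrime 5) (hap : V.frobeniusTrace 5 = 0)
    (hns : ¬ ∀ m : ℕ, V.HasSurjectiveModNGaloisRep (5 ^ m : ℕ))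
    (hX : ∀ {N : ℕ} [NeZero N] {f : CuspForm (Gamma0 N) 2}, IsNewformOf V f →
      ∀ (ϖ : ℚ), (if Even (5 / 2) then (ϖ : ℝ) * V.realPeriodRat = plusPeriod f
          else (ϖ : ℝ) * V.imaginaryPeriodRat = minusPeriod f) →
      ∀ (Lη : IwasawaAlgebra 5), IsQuadraticBranchPlusLFunction f 5 ϖ Lη →
        Ideal.span {Lη} = Ideal.span {(PowerSeries.X : IwasawaAlgebra 5)})
    (hP : haveI : W.IsElliptic := hW ▸ isElliptic_243675bl1
      haveI : NeZero (5 : ℕ) := ⟨by norm_num⟩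
      haveI : NumberField (W.divisionField 5) := NumberField.mk
      ∃ P : geomTorsion W ((5 : ℕ) : ℤ), P ≠ 0 ∧
        ∀ K : IntermediateField ℚ (W.divisionField 5),
          K = IntermediateField.fixedField
            ((MulAction.stabilizer (absoluteGaloisGroup ℚ) P).map (absRestrictNormalHom (W.divisionField 5))) →
        ∀ μ : Additive (ClassGroup (𝓞 K)) →+ ZMod 5,
          (∀ (τ : absoluteGaloisGroup ℚ) (σ : K ≃ₐ[ℚ] K) (a : ℕ),
              (∀ x : K, absRestrictNormalHom (W.divisionField 5) τ (x : W.divisionField 5) =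
                ((σ x : K) : W.divisionField 5)) → τ • P = a • P →
              ∀ (I J : (Ideal (𝓞 K))⁰),
                (J : Ideal (𝓞 K)) = (I : Ideal (𝓞 K)).map (AmbiguousClass.intAut σ : 𝓞 K →+* 𝓞 K) →
                μ (Additive.ofMul (ClassGroup.mk0 J)) = a • μ (Additive.ofMul (ClassGroup.mk0 I))) →
          (∀ (τ τ₁ : absoluteGaloisGroup ℚ) (a a₁ b : ℕ) (Q : geomTorsion W ((5 : ℕ) : ℤ)),
              τ • P = a • P + Q → τ₁ • P = a₁ • P → τ₁ • Q = b • Q → (a₁ : ZMod 5) ≠ (b : ZMod 5) →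
              ∀ I : (Ideal (𝓞 K))⁰,
                μ (Additive.ofMul (classGroupNorm K (W.divisionField 5) (ClassGroup.mulEquiv
                  (AmbiguousClass.intAut (absRestrictNormalHom (W.divisionField 5) τ))
                    (classGroupExtend K (W.divisionField 5) (ClassGroup.mk0 I))))) =
                  (Nat.card ((W.divisionField 5) ≃ₐ[K] (W.divisionField 5)) * a) •
                    μ (Additive.ofMul (ClassGroup.mk0 I))) →
          μ = 0) :
    QuadraticBranchPlusEtaMainConjectureAt V 5 := by
  subst hW
  haveI : (⟨0, 0, 1, 0, 11281⟩ : WeierstrassCurve ℚ).IsElliptic := isElliptic_243675bl1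
  haveI : NeZero (5 : ℕ) := ⟨by norm_num⟩
  exact etaMC_r1_of_heckeEigenHom h22 h41 h6273 hGZK 5 (le_refl 5) _ hr V C
    (by rw [show ((-1 : ℚ) ^ ((5 : ℕ) / 2) * ((5 : ℕ) : ℚ)) = 5 by norm_num]; exact hC) hgood hap hns hX hP

/-- `324900en1` = `[0, 0, 0, 0, -857375]` (CM, `j = 0`, `N = 324900`): `Δ ≠ 0` (kernel). [cite: Cremona1997, Table 1 (label 324900en1)] -/
theorem isElliptic_324900en1 : (⟨0, 0, 0, 0, (-857375)⟩ : WeierstrassCurve ℚ).IsElliptic :=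
  isElliptic_of_discOf_ne_zero 0 0 0 0 (-857375) (by decide +kernel)

/-- **(C1⁺_η) at `p = 5` for every good `a_5 = 0` model `V` of the `5`-twist of `324900en1`** (`W = [0, 0, 0, 0, -857375]`, CM, `j = 0`, `N = 324900`;
Cremona `r_an(W) = 1`; PARI plus-`η` `(λ, μ) = (1, 0)`; census j326603 / j326929 / j326822 (GRH): `h(ℚ(P)) = 20`, `h(ℚ(x(P))) = 1`, `d₂ = 1`, `s_W = 0`; hecke13: TWIST, `c = 1 ≠ Tr = 4` — the plain class-number door and
door L6⁻ are VOID, the Hecke door passes: the tautological class comes from the ROW curve `V = W^5`, not from `W`) from the ROW ALONE —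
named facts `h22 h41 h6273 hGZK`; displayed `r_an(W) = 1`, the tower clause, `(L_5⁺(V,η,X)) = (X)`, the Hecke-refined eigen datum. Instance of
`etaMC_r1_of_heckeEigenHom`. CONDITIONAL; nothing booked. [cite: Kobayashi2003, §4 (p. 8)] [cite: DeoRaySujatha2023, §3 Thm. 3.8]
[cite: Cremona1997, Table 1 (label 324900en1)] -/
theorem etaMC_r1_324900en1_5_of_heckeEigenHom
    (h22 : Kobayashi2003.thm22_etaSignedSelmerDual_finite_torsion)
    (h41 : Kobayashi2003.thm41_plusEtaCharIdeal_dvd)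
    (h6273 : Kobayashi2003.thm62_63_73_etaColemanPoitouTate)
    (hGZK : rank_eq_analyticRank_of_analyticRank_le_one) [Fact (5 : ℕ).Prime]
    (W : WeierstrassCurve ℚ) (hW : W = (⟨0, 0, 0, 0, (-857375)⟩ : WeierstrassCurve ℚ)) (hr : W.analyticRank = 1)
    (V : WeierstrassCurve ℚ) [V.IsElliptic] [V.IsGloballyMinimal] (C : VariableChange ℚ)
    (hC : C • W.quadraticTwist 5 = V)
    (hgood : V.HasGoodReductionAtPrime 5) (hap : V.frobeniusTrace 5 = 0)
    (hns : ¬ ∀ m : ℕ, V.HasSurjectiveModNGaloisRep (5 ^ m : ℕ))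
    (hX : ∀ {N : ℕ} [NeZero N] {f : CuspForm (Gamma0 N) 2}, IsNewformOf V f →
      ∀ (ϖ : ℚ), (if Even (5 / 2) then (ϖ : ℝ) * V.realPeriodRat = plusPeriod f
          else (ϖ : ℝ) * V.imaginaryPeriodRat = minusPeriod f) →
      ∀ (Lη : IwasawaAlgebra 5), IsQuadraticBranchPlusLFunction f 5 ϖ Lη →
        Ideal.span {Lη} = Ideal.span {(PowerSeries.X : IwasawaAlgebra 5)})
    (hP : haveI : W.IsElliptic := hW ▸ isElliptic_324900en1
      haveI : NeZero (5 : ℕ) := ⟨by norm_num⟩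
      haveI : NumberField (W.divisionField 5) := NumberField.mk
      ∃ P : geomTorsion W ((5 : ℕ) : ℤ), P ≠ 0 ∧
        ∀ K : IntermediateField ℚ (W.divisionField 5),
          K = IntermediateField.fixedField
            ((MulAction.stabilizer (absoluteGaloisGroup ℚ) P).map (absRestrictNormalHom (W.divisionField 5))) →
        ∀ μ : Additive (ClassGroup (𝓞 K)) →+ ZMod 5,
          (∀ (τ : absoluteGaloisGroup ℚ) (σ : K ≃ₐ[ℚ] K) (a : ℕ),
              (∀ x : K, absRestrictNormalHom (W.divisionField 5) τ (x : W.divisionField 5) =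
                ((σ x : K) : W.divisionField 5)) → τ • P = a • P →
              ∀ (I J : (Ideal (𝓞 K))⁰),
                (J : Ideal (𝓞 K)) = (I : Ideal (𝓞 K)).map (AmbiguousClass.intAut σ : 𝓞 K →+* 𝓞 K) →
                μ (Additive.ofMul (ClassGroup.mk0 J)) = a • μ (Additive.ofMul (ClassGroup.mk0 I))) →
          (∀ (τ τ₁ : absoluteGaloisGroup ℚ) (a a₁ b : ℕ) (Q : geomTorsion W ((5 : ℕ) : ℤ)),
              τ • P = a • P + Q → τ₁ • P = a₁ • P → τ₁ • Q = b • Q → (a₁ : ZMod 5) ≠ (b : ZMod 5) →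
              ∀ I : (Ideal (𝓞 K))⁰,
                μ (Additive.ofMul (classGroupNorm K (W.divisionField 5) (ClassGroup.mulEquiv
                  (AmbiguousClass.intAut (absRestrictNormalHom (W.divisionField 5) τ))
                    (classGroupExtend K (W.divisionField 5) (ClassGroup.mk0 I))))) =
                  (Nat.card ((W.divisionField 5) ≃ₐ[K] (W.divisionField 5)) * a) •
                    μ (Additive.ofMul (ClassGroup.mk0 I))) →
          μ = 0) :
    QuadraticBranchPlusEtaMainConjectureAt V 5 := by
  subst hW
  haveI : (⟨0, 0, 0, 0, (-857375)⟩ : WeierstrassCurve ℚ).IsElliptic := isElliptic_324900en1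
  haveI : NeZero (5 : ℕ) := ⟨by norm_num⟩
  exact etaMC_r1_of_heckeEigenHom h22 h41 h6273 hGZK 5 (le_refl 5) _ hr V C
    (by rw [show ((-1 : ℚ) ^ ((5 : ℕ) / 2) * ((5 : ℕ) : ℚ)) = 5 by norm_num]; exact hC) hgood hap hns hX hP

end Summit.BirchSwinnertonDyer.BirchSwinnertonDyer.Theorems.EtaConjADoorHeckeRecords

end
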